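import Summits.Ventures.HodgeRepro2.T5LevelIdempotentFinite

/-!
# The trace formula for `dim V^K` (Tier-5 kernel support, seat p8)

For a normal subgroup `H ◁ K` of finite index with `V^H` finite-dimensional, the dimension of the
`K`-invariants is the average over the finite group `K ⧸ H` of the character of the quotient
representation on `V^H` (`finrank_invariants_eq_average_trace`):
`dim V^K = [K : H]⁻¹ · Σ_{q ∈ K/H} tr(q | V^H)`.  It is Mathlib's `IsProj.trace` applied to the
finite-group averaging projector identified in `T5LevelIdempotentFinite` with the level idempotent
`e_K` — the classical way of counting invariants (multiplicity of the trivial `K`-type) from a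
character table.  Nothing is asserted about any specific group.
-/

namespace Summit.Ventures.HodgeRepro2.T5LevelTraceFormula

open Summit.Ventures.HodgeRepro2.LevelPositivity Summit.Ventures.HodgeRepro2.T5LevelIdempotent
  Summit.Ventures.HodgeRepro2.T5LevelIdempotentFinite

variable {G : Type*} [Group G] {k : Type*} [Field k] {V : Type*} [AddCommGroup V] [Module k V]
  (ρ : Representation k G V) {K : Subgroup G} (H : Subgroup K) [H.Normal]

/-- The invariants of the quotient representation, pushed into `V`, are the `K`-invariants. -/
theorem map_invariants_quotientRep :
    ((quotientRep ρ H).invariants).map (invariants (restrict ρ K) H).subtype = invariants ρ K := by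
  ext x
  constructor
  · intro hx
    obtain ⟨y, hy, rfl⟩ := Submodule.mem_map.1 hx
    exact (mem_invariants_quotientRep_iff ρ H y).1 hy
  · intro hx
    have hxH : x ∈ invariants (restrict ρ K) H :=
      mem_invariants_iff.2 fun h _ => mem_invariants_iff.1 hx h h.2
    exact Submodule.mem_map.2 ⟨⟨x, hxH⟩, (mem_invariants_quotientRep_iff ρ H ⟨x, hxH⟩).2 hx, rfl⟩

/-- `dim (V^H)^{K/H} = dim V^K`. -/
theorem finrank_invariants_quotientRep :
    Module.finrank k ((quotientRep ρ H).invariants) = Module.finrank k (invariants ρ K) := by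
  rw [← map_invariants_quotientRep ρ H]
  exact (Submodule.equivMapOfInjective _ (Submodule.subtype_injective _) _).finrank_eq

variable [Fintype (K ⧸ H)] [Invertible (Fintype.card (K ⧸ H) : k)]
  [FiniteDimensional k (invariants (restrict ρ K) H)]

omit [FiniteDimensional k (invariants (restrict ρ K) H)] in
/-- The trace of the averaging projector of `K ⧸ H` on `V^H` is the averaged character. -/
theorem trace_averageMap_quotientRep :
    LinearMap.trace k _ (Representation.averageMap (quotientRep ρ H)) =
      (Fintype.card (K ⧸ H) : k)⁻¹ *
        ∑ q : K ⧸ H, LinearMap.trace k _ (quotientRep ρ H q) := by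
  rw [Representation.averageMap, GroupAlgebra.average, map_smul, map_sum]
  simp only [Representation.asAlgebraHom_of]
  rw [map_smul, map_sum, invOf_eq_inv, smul_eq_mul]

/-- THE TRACE FORMULA: `dim V^K = [K : H]⁻¹ · Σ_{q ∈ K/H} tr(q | V^H)`. -/
theorem finrank_invariants_eq_average_trace :
    (Module.finrank k (invariants ρ K) : k) =
      (Fintype.card (K ⧸ H) : k)⁻¹ *
        ∑ q : K ⧸ H, LinearMap.trace k _ (quotientRep ρ H q) := by
  rw [← trace_averageMap_quotientRep ρ H, (Representation.isProj_averageMap (quotientRep ρ H)).trace,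
    finrank_invariants_quotientRep ρ H]

/-- The same formula with the index `[K : H]`. -/
theorem finrank_invariants_eq_average_trace' :
    (H.index : k) * (Module.finrank k (invariants ρ K) : k) =
      ∑ q : K ⧸ H, LinearMap.trace k _ (quotientRep ρ H q) := by
  rw [finrank_invariants_eq_average_trace ρ H, Subgroup.index_eq_card, Nat.card_eq_fintype_card,
    ← mul_assoc, mul_inv_cancel₀ (Invertible.ne_zero _), one_mul]

end Summit.Ventures.HodgeRepro2.T5LevelTraceFormula
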